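import Summits.BirchSwinnertonDyer.Rank1Residual.Additive.SignedTwistOddLayerWitness
import Summits.BirchSwinnertonDyer.Rank1Residual.Additive.StrictSignedInvariantDescent
import Summits.BirchSwinnertonDyer.Rank1Residual.Additive.KobayashiSignedGenerationRat
import Summits.BirchSwinnertonDyer.Rank1Residual.Additive.SignedTwistLocalGalois
import Summits.BirchSwinnertonDyer.Rank1Residual.Additive.CyclotomicTowerSignedSelmerDual
import Summits.BirchSwinnertonDyer.Rank1Residual.Additive.QuadraticTwistTypeG
import Summits.BirchSwinnertonDyer.Rank1Residual.Additive.QuadraticTwistPadicNoPTorsion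
import HarnessLib

/-!
# B3's corank half for the signed twist with NO point-level input: `p^m` distinct classes of
# `H¹(ℚ_p, W[p^m])` restricting to Kummer classes of zero-clause minus points
# (cell `b2b-bsdres`, CLASS-CLOSURE lane, class O10 — x1b GEN 40, class lead; file 91 of the series)

HONEST FRAMING (cell `b2b-bsdres`, run/shared/lean/b2b/bsd-rank1-residual/, verbatim in every
file): the goal of the cell is to DELETE the COMBINATION-SHAPED residual classes of the
Birch–Swinnerton-Dyer formula for ALL analytic-rank `≤ 1` elliptic curves over `ℚ` — "full BSD
formula for every rank `≤ 1` curve in class `C`" assembled STRICTLY from published theorems — so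
that the rank-`≤ 1` remainder becomes exactly the CONSTRUCTION-SHAPED classes, which are TYPED
(missing-input `Prop`s), NOT attempted. This is not "finishing BSD". CLASS-CLOSURE lane: prove
what is provable now; shrink each hard class to its core with data; no claim beyond stated classes;
research routes on CONSTRUCTION-SHAPED X12 / O10; census / instrument output = EVIDENCE / conjecture
items, NEVER a Literature fact; `RESIDUAL-MAP.md` marks change only by signed lines. THIS FILE:
TOOL THEOREMS ONLY — no definition, no named Literature fact, no `sorry`, axioms standard; nothing
is booked; no label / mark / count / sub-cell moves; (C1_η), (C2_η-GZ), (C3_η) stay typed as filed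
(cc-typer-6's pen); nothing about `BSD(W, p)` of any pair is claimed.

## What

The composition of files 81/82 (x1b GEN 39: `p^{min(m,#S)}` distinct classes of `H¹(E, E[p^m])`
restricting to Kummer classes of zero-clause minus points, from witness layers `S`, no `p`-torsion
and a unit `κ`-value element) with file 90 (x1b GEN 40: WITNESSES at every odd layer for the signed
twist) at `E = ℚ_p`, `ι = closureEmb ℚ_p`:

* §1 **`exists_finset_galoisCohomology_minus_of_le`** (generic tower hypotheses of n1011-p17's
  dictionary: `K₀ ∋ θ = √c` Galois of index `≤ p − 1` carrying the local cyclotomic tower, (D0),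
  `κ(Gal(ℚ̄/K₀)) = ℤ_p`, a good supersingular `a_p = 0` model `M` of `V = C • W^{(c)}`, `p` odd):
  for `2m ≤ n + 1` there are **`p^m` DISTINCT classes of `H¹(ℚ_p, W[p^m])`** each restricting on
  `Gal(ℚ̄_p/ℚ_n·ℚ_p)` to the Kummer cocycle `u ↦ uR − R` of a `p^m`-th root `R` of a zero-clause
  minus point `x ∈ E⁻_W(ℚ_n·ℚ_p) ∩ ker Tr_{n/0}`. ALL point-level inputs discharged here: the unit
  element (from (D0) + `κ(Gal(ℚ̄/K₀)) = ℤ_p`), `W(ℚ_n·ℚ_p)[p] = 0` (Prop. 8.7 on the `V`-side through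
  `Ψ`), the witnesses at the odd layers `1, 3, …, 2m − 1` (file 90).
* §2 **`…_cyclotomic`**: Kobayashi's setting verbatim — `K₀ = ℚ(μ_p)` (any `p`-th cyclotomic
  field `F`), `θ = √p*` (the quadratic Gauss sum), `κ` CYCLOTOMIC, `V = C • W^{(p*)}` with a good
  supersingular `a_p = 0` model (or: `V` globally minimal with good reduction at `p` and
  `a_p(V) = 0`, `…_of_goodSupersingular`): the tower hypotheses are theorems of the tree
  (`localTowerHyp_padic`, `kappa_surjOn_galRange_cyclotomic`, `normal/index_galRange_cyclotomic`,
  `localSubgroupOfEmb_towerSubgroup_eq_stab_rat`).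

This is the corank-ONE half of [Kobayashi2003] Thm. 6.2 on the `η`-component (`#Σ_m ≥ p^m` for
the level-`m` minus condition at `p` of the TWIST `W`) WITHOUT Coleman maps, Honda's structure
theorem for the logarithm lattice, or any `Λ`-module theory — brick B3 of the count (C) up to the
receptacle (x1b GEN 39 note §3 (iii)/(iv): cyclicity `#Σ_m[p] ≤ p` from transversality +
`#H¹(ℚ_p, W[p]) = p²`, and the packaging of `Σ_m`). NOT claimed: (C1_η), (C2_η-GZ), (C3_η), B3 as a
statement about a named receptacle, any `BSD(W, p)`.

References: [Kobayashi2003] S. Kobayashi, Invent. Math. 152 (2003), §2 p. 4, Def. 1.1, §3 p. 5,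
§4 p. 8, Thm. 6.2 (p. 11), Prop. 8.7 (p. 16), Prop. 8.12 (p. 17), Lemma 8.17 (p. 19);
[GreenbergLNM1716] §3 p. 86.
-/

noncomputable section

open scoped Classical

open WeierstrassCurve Field

namespace Summit.BirchSwinnertonDyer.Rank1Residual.Additive.SignedTwist

open Literature.NumberTheory.EllipticCurves Literature.NumberTheory.GaloisRepresentations
  Literature.NumberTheory.EllipticCurves.Kobayashi2003 Literature.NumberTheory.EllipticCurves.ZpDescent
  Summit.BirchSwinnertonDyer.Rank1Residual.AdditivePotMult
  Summit.BirchSwinnertonDyer.Rank1Residual.Additive.PadicCyclotomicTower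
  Summit.BirchSwinnertonDyer.Rank1Residual.Additive.StrictSignedCount
  ZpExtension
open scoped ContRepresentation

/-! ## §1 The corank bound under the generic tower hypotheses -/

section Generic

variable (W : WeierstrassCurve ℚ) [W.IsElliptic] (K₀ : Type) [Field K₀] [NumberField K₀] {θ : K₀} {c : ℚ}
  (hθ : θ ∉ Set.range (algebraMap ℚ K₀)) (hc : θ ^ 2 = algebraMap ℚ K₀ c)
  {p : ℕ} [hp : Fact p.Prime] (κ : ZpExtension ℚ p)
  {V : WeierstrassCurve ℚ} [V.IsElliptic] {C : VariableChange ℚ} (hCV : C • W.quadraticTwist c = V)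
  (η : absoluteGaloisGroup ℚ →* ℤˣ)
  (hη : ∀ σ : absoluteGaloisGroup ℚ, η σ = 1 ↔ σ • rootInClosure K₀ θ = rootInClosure K₀ θ)

omit [W.IsElliptic] in
include hθ hc hCV hη in
/-- **`W(ℚ_n·ℚ_p)` has no `p`-torsion** (Prop. 8.7 on the `V`-side, read through `Ψ`).
[cite: Kobayashi2003, Prop. 8.7 (p. 16)] -/
theorem eq_zero_of_prime_smul_eq_zero_localLayerPointsOfEmb (hp2 : p ≠ 2)
    (M : WeierstrassCurve ℤ_[p]) [(M.map PadicInt.Coe.ringHom).IsElliptic]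
    [(M.map PadicInt.toZMod).IsElliptic]
    (htr : Literature.NumberTheory.EllipticCurves.HasseManin.tr (M.map PadicInt.toZMod) = 0)
    (hVM : M.baseChange (AlgebraicClosure ℚ_[p]) = V.baseChange (AlgebraicClosure ℚ_[p]))
    [(galRange (K := ℚ) K₀).Normal]
    (hU : ∀ n, localSubgroupOfEmb (towerSubgroup κ K₀ n) (closureEmb (K := ℚ) ℚ_[p]) = stab p (n + 1))
    (n : ℕ) : ∀ P ∈ localLayerPointsOfEmb κ (closureEmb (K := ℚ) ℚ_[p]) W n, p • P = 0 → P = 0 := by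
  intro P hP hpP
  set ι := closureEmb (K := ℚ) ℚ_[p] with hι
  set Ψ := localTransport W K₀ hθ hc hCV ℚ_[p] ι with hΨ
  have hΨP : Ψ P ∈ localFixedPointsOfEmb ι V (towerSubgroup κ K₀ n) :=
    (localTransport_mem_localFixedPoints_and_eigen W K₀ hθ hc κ hCV ι η hη hP).1
  have h := eq_zero_of_prime_pow_smul_eq_zero_localFixedPointsOfEmb_of_stab ι V (towerSubgroup κ K₀)
    hp2 M (isUnit_Δ_of_isElliptic_toZMod p M) (hasseCoeff_mem_maximalIdeal_of_tr_eq_zero hp2 M htr)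
    hVM hU n 1 (Ψ P) hΨP (by rw [pow_one, ← map_nsmul, hpP, map_zero])
  exact (map_eq_zero_iff Ψ Ψ.injective).mp h

include hθ hc hCV hη in
/-- **B3's corank half for the signed twist, no point-level input.** Under the generic tower
hypotheses (module docstring) and `2m ≤ n + 1`: there are `p^m` DISTINCT classes of
`H¹(ℚ_p, W[p^m])`, each represented by a continuous cocycle whose values on `Gal(ℚ̄_p/ℚ_n·ℚ_p)`
are `u ↦ uR − R` with `p^m R` a zero-clause minus point of `W(ℚ_n·ℚ_p)` (files 81/82 with the
witnesses of file 90 at the odd layers `1, 3, …, 2m − 1`).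
[cite: Kobayashi2003, Thm. 6.2 (p. 11), Prop. 8.7 (p. 16), Prop. 8.12 (p. 17), Lemma 8.17 (p. 19)] -/
theorem exists_finset_galoisCohomology_minus_of_le
    (hD : ∀ g : absoluteGaloisGroup ℚ, ∃ τ : absoluteGaloisGroup ℚ_[p],
      (resGalOfEmb (closureEmb (K := ℚ) ℚ_[p]) τ)⁻¹ * g ∈ towerTopSubgroup κ K₀)
    (hκ₀ : ∀ x, ∃ g ∈ galRange (K := ℚ) K₀, κ g = x) [(galRange (K := ℚ) K₀).Normal]
    (hidx : (galRange (K := ℚ) K₀).index ≤ p - 1) (hp2 : p ≠ 2)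
    (M : WeierstrassCurve ℤ_[p]) [hE : (M.map PadicInt.Coe.ringHom).IsElliptic]
    [hEt : (M.map PadicInt.toZMod).IsElliptic]
    (htr : Literature.NumberTheory.EllipticCurves.HasseManin.tr (M.map PadicInt.toZMod) = 0)
    (hVM : M.baseChange (AlgebraicClosure ℚ_[p]) = V.baseChange (AlgebraicClosure ℚ_[p]))
    (hU : ∀ n, localSubgroupOfEmb (towerSubgroup κ K₀ n) (closureEmb (K := ℚ) ℚ_[p]) = stab p (n + 1))
    {n m : ℕ} (hnm : 2 * m ≤ n + 1) :
    ∃ Ξ : Finset (galoisCohomology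
        (GaloisRep.restrictField ℚ_[p] (W.torsionGaloisModule ((p ^ m : ℕ) : ℤ))) 1),
      Ξ.card = p ^ m ∧
      ∀ ξ ∈ Ξ, ∃ x ∈ signedLocalPointsOfEmb κ (closureEmb (K := ℚ) ℚ_[p]) W (-1) n ⊓
          (localTraceOfEmb κ (closureEmb (K := ℚ) ℚ_[p]) W 0 n).ker,
        ∃ R : localPoints W ℚ_[p], ((p ^ m : ℕ) : ℤ) • R = x ∧
        ∃ φ : contOneCocycles (DiscreteGaloisModule.toTopRep
            (GaloisRep.restrictField ℚ_[p] (W.torsionGaloisModule ((p ^ m : ℕ) : ℤ)))),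
          oneCocycleClass _ φ = ξ ∧
          ∀ u ∈ localLayerSubgroupOfEmb κ (closureEmb (K := ℚ) ℚ_[p]) n,
            pointsMap W ℚ_[p] ((φ.1 u : geomTorsion W ((p ^ m : ℕ) : ℤ)) : geomPoints W) = u • R - R := by
  set ι := closureEmb (K := ℚ) ℚ_[p] with hι
  -- an element of unit `κ`-value in the decomposition group
  obtain ⟨g, -, hgx⟩ := exists_resGalOfEmb_mem_galRange_and_kappa_eq κ K₀ ι hD hκ₀ (Multiplicative.ofAdd 1)
  have hg : IsUnit (κ (resGalOfEmb ι g)).toAdd := by rw [hgx, toAdd_ofAdd]; exact isUnit_one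
  -- no `p`-torsion in `W(ℚ_n·ℚ_p)`
  have htors := eq_zero_of_prime_smul_eq_zero_localLayerPointsOfEmb W K₀ hθ hc κ hCV η hη hp2 M htr hVM hU n
  -- the witness layers `1, 3, …, 2m − 1`
  set S : Finset ℕ := (Finset.range m).image (fun i => 2 * i + 1) with hS
  have hScard : S.card = m := by
    rw [hS, Finset.card_image_of_injective _ (fun a b h => by simpa using h), Finset.card_range]
  have hS0 : 0 ∉ S := by
    intro h
    obtain ⟨i, -, hi⟩ := Finset.mem_image.mp h
    omega
  have hSn : ∀ k ∈ S, k ≤ n := by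
    intro k hk
    obtain ⟨i, hi, rfl⟩ := Finset.mem_image.mp hk
    rw [Finset.mem_range] at hi
    omega
  have hwit : ∀ k ∈ S, ∃ w ∈ signedLocalPointsOfEmb κ ι W (-1) k ⊓ (localTraceOfEmb κ ι W 0 k).ker,
      ¬ ∃ a ∈ localLayerPointsOfEmb κ ι W k, ∃ b ∈ localLayerPointsOfEmb κ ι W (k - 1),
        w = p • a + b := by
    intro k hk
    obtain ⟨i, -, rfl⟩ := Finset.mem_image.mp hk
    exact exists_zeroClause_witness_of_odd W K₀ hθ hc κ hCV ι η hη hD hκ₀ hidx hp2 M htr hVM hU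
      (odd_two_mul_add_one i)
  obtain ⟨Ξ, hcard, hΞ⟩ := exists_finset_galoisCohomology_of_zeroClause' κ ℚ_[p] W g hg n m htors S hS0 hSn hwit
  exact ⟨Ξ, by rw [hcard, hScard, min_self], hΞ⟩

end Generic

/-! ## §2 Kobayashi's setting verbatim: `K₀ = ℚ(μ_p)`, `θ = √p*`, `κ` cyclotomic -/

section Cyclotomic

variable (W : WeierstrassCurve ℚ) [W.IsElliptic] {p : ℕ} [hp : Fact p.Prime] (κ : ZpExtension ℚ p)
  {V : WeierstrassCurve ℚ} [V.IsElliptic]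
  (F : Type) [Field F] [NumberField F] [IsCyclotomicExtension {p} ℚ F]

include F in
/-- **B3's corank half for the `p*`-twist, Kobayashi's setting** (`F` a `p`-th cyclotomic field,
`κ` cyclotomic, `V = C • W^{(p*)}` with a good supersingular `a_p = 0` model `M`, `p` odd,
`2m ≤ n + 1`): `p^m` distinct classes of `H¹(ℚ_p, W[p^m])` restricting to Kummer cocycles of
`p^m`-th roots of zero-clause minus points of `W(ℚ_n·ℚ_p)` — all tower hypotheses discharged.
[cite: Kobayashi2003, §3 p. 5, §4 p. 8, Thm. 6.2 (p. 11), Prop. 8.7 (p. 16), Prop. 8.12 (p. 17)] -/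
theorem exists_finset_galoisCohomology_minus_of_le_cyclotomic (hp2 : p ≠ 2) (hκ : κ.IsCyclotomic)
    (C : VariableChange ℚ) (hCV : C • W.quadraticTwist ((-1) ^ (p / 2) * p) = V)
    (M : WeierstrassCurve ℤ_[p]) [hE : (M.map PadicInt.Coe.ringHom).IsElliptic]
    [hEt : (M.map PadicInt.toZMod).IsElliptic]
    (htr : Literature.NumberTheory.EllipticCurves.HasseManin.tr (M.map PadicInt.toZMod) = 0)
    (hVM : M.baseChange (AlgebraicClosure ℚ_[p]) = V.baseChange (AlgebraicClosure ℚ_[p]))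
    {n m : ℕ} (hnm : 2 * m ≤ n + 1) :
    ∃ Ξ : Finset (galoisCohomology
        (GaloisRep.restrictField ℚ_[p] (W.torsionGaloisModule ((p ^ m : ℕ) : ℤ))) 1),
      Ξ.card = p ^ m ∧
      ∀ ξ ∈ Ξ, ∃ x ∈ signedLocalPointsOfEmb κ (closureEmb (K := ℚ) ℚ_[p]) W (-1) n ⊓
          (localTraceOfEmb κ (closureEmb (K := ℚ) ℚ_[p]) W 0 n).ker,
        ∃ R : localPoints W ℚ_[p], ((p ^ m : ℕ) : ℤ) • R = x ∧
        ∃ φ : contOneCocycles (DiscreteGaloisModule.toTopRep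
            (GaloisRep.restrictField ℚ_[p] (W.torsionGaloisModule ((p ^ m : ℕ) : ℤ)))),
          oneCocycleClass _ φ = ξ ∧
          ∀ u ∈ localLayerSubgroupOfEmb κ (closureEmb (K := ℚ) ℚ_[p]) n,
            pointsMap W ℚ_[p] ((φ.1 u : geomTorsion W ((p ^ m : ℕ) : ℤ)) : geomPoints W) = u • R - R := by
  -- `θ = √p* ∈ F`, not rational
  obtain ⟨θ, hθ2⟩ := exists_sq_eq_pStar p F hp2
  have hc : θ ^ 2 = algebraMap ℚ F ((-1) ^ (p / 2) * p) := by
    rw [hθ2, map_mul, map_pow, map_neg, map_one, map_natCast]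
  have hθ : θ ∉ Set.range (algebraMap ℚ F) := by
    rintro ⟨q, hq⟩
    apply sq_ne_neg_one_pow_mul_prime hp.out (p / 2) q
    apply (algebraMap ℚ F).injective
    rw [map_pow, hq, hc]
  obtain ⟨η, hη⟩ := exists_eta_iff_smul_rootInClosure F hθ hc
  haveI := normal_galRange_cyclotomic p F
  exact exists_finset_galoisCohomology_minus_of_le W F hθ hc κ hCV η hη
    (localTowerHyp_padic p κ F hκ) (kappa_surjOn_galRange_cyclotomic κ F)
    (index_galRange_cyclotomic p F).le hp2 M htr hVM
    (localSubgroupOfEmb_towerSubgroup_eq_stab_rat F (closureEmb (K := ℚ) ℚ_[p]) κ hp2 hκ) hnm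

include F in
/-- **The same for a globally minimal `V` with good reduction at `p` and `a_p(V) = 0`** (the model is
supplied by `exists_padicModel_tr_eq_zero`). [cite: Kobayashi2003, Thm. 6.2 (p. 11), Prop. 8.12 (p. 17)]
[cite: SilvermanAEC2009, VII.5 Prop. 5.1(a)] -/
theorem exists_finset_galoisCohomology_minus_of_le_of_goodSupersingular [V.IsGloballyMinimal]
    (hp2 : p ≠ 2) (hκ : κ.IsCyclotomic)
    (C : VariableChange ℚ) (hCV : C • W.quadraticTwist ((-1) ^ (p / 2) * p) = V)
    (hgood : V.HasGoodReductionAtPrime p) (hap : V.frobeniusTrace p = 0)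
    {n m : ℕ} (hnm : 2 * m ≤ n + 1) :
    ∃ Ξ : Finset (galoisCohomology
        (GaloisRep.restrictField ℚ_[p] (W.torsionGaloisModule ((p ^ m : ℕ) : ℤ))) 1),
      Ξ.card = p ^ m ∧
      ∀ ξ ∈ Ξ, ∃ x ∈ signedLocalPointsOfEmb κ (closureEmb (K := ℚ) ℚ_[p]) W (-1) n ⊓
          (localTraceOfEmb κ (closureEmb (K := ℚ) ℚ_[p]) W 0 n).ker,
        ∃ R : localPoints W ℚ_[p], ((p ^ m : ℕ) : ℤ) • R = x ∧
        ∃ φ : contOneCocycles (DiscreteGaloisModule.toTopRep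
            (GaloisRep.restrictField ℚ_[p] (W.torsionGaloisModule ((p ^ m : ℕ) : ℤ)))),
          oneCocycleClass _ φ = ξ ∧
          ∀ u ∈ localLayerSubgroupOfEmb κ (closureEmb (K := ℚ) ℚ_[p]) n,
            pointsMap W ℚ_[p] ((φ.1 u : geomTorsion W ((p ^ m : ℕ) : ℤ)) : geomPoints W) = u • R - R := by
  obtain ⟨M, hE, hEt, htr, hVM⟩ := exists_padicModel_tr_eq_zero V hgood hap
  haveI := hE; haveI := hEt
  exact exists_finset_galoisCohomology_minus_of_le_cyclotomic W κ F hp2 hκ C hCV M htr hVM hnm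

end Cyclotomic

end Summit.BirchSwinnertonDyer.Rank1Residual.Additive.SignedTwist

end
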